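import Summits.ABC.IUTFork.Thm311Multirad
import Literature.IUT.HodgeTheaters.Processions
import HarnessLib

/-!
# [IUTchIII] Theorem 3.11 in the author's terms, K: (Ind1) against the landed typing of processions ([IUTchI] Def. 4.10)

Record-only file (D-0012) of the abc-iut cell (Cor. 3.12 sub-crew, seat abc-iut-c312-1, gen 2); TAKES NO
SIDE. File A (`Thm311Sig`) DEFINED the indeterminacy (Ind1) of [IUTchIII] Thm. 3.11 (i) (kurims
`paper:url-4b091feeb646` p. 154: "(Ind1) the indeterminacies induced by the automorphisms of the procession
of `D⊢`-prime-strips `Prc(^{n,∘}D⊢_T)`") as an explicit set of families of linear automorphisms of the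
tensor packets: at each label `j ∈ |F_l|` ONE permutation `σ` of the capsule index set `S^±_{j+1}` shared by
all `v_ℚ`, together with an arbitrary induced strip-automorphism on the summand `v` of the factor `i`, for
every `(i, v)` — reading [IUTchI] Def. 4.10 (automorphisms of processions) with §0 ("A capsule-full
poly-morphism … is defined to be the poly-morphism associated to some [fixed] injection `ι : J ↪ J′` which
consists of the set of morphisms of `Capsule(C)` given by collections of [arbitrary] isomorphisms `A_j ⥲
A′_{ι(j)}`, for `j ∈ J`. A capsule-full poly-isomorphism is a capsule-full poly-morphism for which the
associated injection between index sets is a bijection", kurims `paper:url-690e7b3c6199` p. 34).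

Since then layer L5 (seat abc-iut-L5-t3) has LANDED [IUTchI] Def. 4.10 statements-first as
`Literature.IUT.HodgeTheaters.Procession C n` (capsule index sets `idx j` with `Nat.card (idx j) = j+1`,
constituents `obj`) and `Procession.Hom` (an order-preserving injection `ι` of `{1,…,n}` with injections of
index sets `emb j : idx j ↪ idx (ι j)` — the capsule-full poly-morphisms carry no further data, being
"all" collections of isomorphisms). This file checks A's (Ind1) against that typing:

* `ThetaIndex.prc` — the INDEX SKELETON of the `l^±`-procession `Prc(^{n,∘}D⊢_T)` of [IUTchI] Prop. 6.9
  (i)/(ii) (p. 169: "the `l^±`-procession of `D`-prime-strips … determined by considering the ["sub"]capsules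
  … corresponding to the subsets `S^±_1 ⊆ … ⊆ S^±_t := {0, 1, 2, …, t−1} ⊆ … ⊆ S^±_{l^±} = |F_l|`") as an L5
  `Procession` of length `l^± = l⋇ + 1` with `idx j := S^±_{j+1} = Fin (j+1)` (A's `ThetaIndex.Caps j`), over
  any assignment of constituent `D⊢`-prime-strips (TODO-merge: abc-iut-L5-t4/L5-t5, [IUTchI] Prop. 6.9, whose
  file is not yet in the tree).
* `ProcessionAut.ι_apply_self`: an automorphism of an `n`-procession has `ι = id` (an order-preserving
  injection of `{1,…,n}` into itself is the identity) — so it preserves every label;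
  `ProcessionAut.perm`: at each level its injection of the (finite) capsule index set into itself is a
  PERMUTATION; `ProcessionAut.ofPerms`/`perm_ofPerms`: conversely EVERY family of permutations, chosen
  independently at each level, is induced by an automorphism (the arrows `P_j ↪ P_{j+1}` being "the
  collection of all capsule-full poly-morphisms", Def. 4.10 imposes no compatibility between levels).
* `LogShells.Ind1_eq_iUnion_aut`: A's (Ind1) at label `j` is EXACTLY the union, over the automorphisms `f`
  of `Prc(^{n,∘}D⊢_T)` as typed by L5, of the families "permute the `j+1` tensor factors by the permutation
  `f` induces on `S^±_{j+1}`, then act by induced strip-automorphisms summand-wise" (`LogShells.ind1Of`);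
  `LogShells.Ind1Family_eq_iUnion_aut`: likewise for B's label-indexed families — one automorphism of the
  procession supplies the permutations at ALL labels simultaneously, with no cross-label constraint.

What this records (bookkeeping, neutral): the permutation part of (Ind1) as typed in A ranges over ALL of
`Perm(S^±_{j+1})` at every label independently — no more (labels are preserved: `ι = id`) and no less — in
agreement with L5's typing of [IUTchI] Def. 4.10 read on the page. This is the reading under which seat
abc-iut-c312-d1's Step (v) note (HOME/plan/c312/STEPV-IND1-NOTE.md: with all capsule permutations the
`e⃗`-component of `hull(U_Θ)` is a min-over-slots quantity) is stated; nothing here bears on whether that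
reading or a coarser one is "intended" beyond what Def. 4.10 / §0 print. Sources read on the page (own
renders): [IUTchI] pp. 33–34 (§0 capsules), 119–120 (Def. 4.10, Fig. 4.6), 169 (Prop. 6.9 (i));
[IUTchIII] p. 154 ((Ind1)). [claim: Mochizuki2012, status: disputed]
Deliberately NOT here: the constituent strips and their isomorphisms (they enter (Ind1) through A's
`stripAut`, the automorphisms of `log(D⊢_v)` induced by functoriality — unchanged); any change to A/B; any
judgement.
-/

noncomputable section

namespace Summit.ABC

namespace IUTFork

namespace Thm311

open Literature.IUT.HodgeTheaters

universe u

/-! ## 1. Automorphisms of a procession, in L5's typing of [IUTchI] Def. 4.10 -/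

namespace ProcessionAut

variable {C : Type u} {n : ℕ} {P : Procession C n}

/-- An automorphism of an `n`-procession PRESERVES EVERY LABEL: its order-preserving injection
`ι : {1,…,n} ↪ {1,…,n}` is the identity (a strictly monotone self-map of a finite linear order satisfies
`x ≤ ι x ≤ x`). [folklore] -/
theorem ι_apply_self (f : P.Hom P) (j : Fin n) : f.ι j = j :=
  le_antisymm f.ι.strictMono.apply_le f.ι.strictMono.le_apply

/-- The index sets of an automorphism's target and source capsules at level `j` coincide. [folklore] -/
theorem idx_ι_eq (f : P.Hom P) (j : Fin n) : P.idx (f.ι j) = P.idx j := by rw [ι_apply_self f j]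

/-- The self-map of the capsule index set underlying the capsule-full poly-morphism `P_j ↪ P_{ι(j)} = P_j`
of an automorphism (L5's injection `emb j`, read back in `idx j` along `idx (ι j) = idx j`). [folklore] -/
def selfMap (f : P.Hom P) (j : Fin n) : P.idx j → P.idx j :=
  fun i => Equiv.cast (idx_ι_eq f j) (f.emb j i)

/-- That self-map is injective. [folklore] -/
theorem selfMap_injective (f : P.Hom P) (j : Fin n) : Function.Injective (selfMap f j) :=
  (Equiv.cast (idx_ι_eq f j)).injective.comp (f.emb j).injective

/-- At each level an automorphism of a procession induces a PERMUTATION of the (finite) capsule index set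
`S_j` — [IUTchI] §0: "A capsule-full poly-isomorphism is a capsule-full poly-morphism for which the
associated injection between index sets is a bijection" (an injective self-map of a finite set is one).
[claim: Mochizuki2012, status: disputed] -/
def perm (f : P.Hom P) (j : Fin n) : Equiv.Perm (P.idx j) :=
  Equiv.ofBijective (selfMap f j) (Finite.injective_iff_bijective.1 (selfMap_injective f j))

/-- The permutation acts by the automorphism's injection of index sets. [folklore] -/
theorem perm_apply (f : P.Hom P) (j : Fin n) (i : P.idx j) :
    perm f j i = Equiv.cast (idx_ι_eq f j) (f.emb j i) := rfl

/-- Conversely, ANY family of permutations of the capsule index sets, chosen independently at each level,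
defines an automorphism of the procession (`ι = id`; the arrows `P_j ↪ P_{j+1}` of Def. 4.10 are "the
collection of all capsule-full poly-morphisms" and impose no compatibility between levels).
[claim: Mochizuki2012, status: disputed] -/
def ofPerms (P : Procession C n) (σ : ∀ j : Fin n, Equiv.Perm (P.idx j)) : P.Hom P where
  ι := OrderEmbedding.id _
  emb j := (σ j).toEmbedding

/-- The permutations induced by `ofPerms σ` are `σ`. [folklore] -/
theorem perm_ofPerms (P : Procession C n) (σ : ∀ j : Fin n, Equiv.Perm (P.idx j)) (j : Fin n) :
    perm (ofPerms P σ) j = σ j := by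
  ext i
  rfl

/-- Hence the permutations induced by automorphisms of a procession are ALL families of permutations of
the capsule index sets: `f ↦ (perm f j)_j` is surjective. [folklore] -/
theorem perm_surjective (P : Procession C n) :
    Function.Surjective fun f : P.Hom P => fun j => perm f j :=
  fun σ => ⟨ofPerms P σ, funext fun j => perm_ofPerms P σ j⟩

/-- In particular any single permutation at one level is induced by an automorphism (identity elsewhere).
[folklore] -/
theorem exists_perm_eq (P : Procession C n) (j : Fin n) (σ : Equiv.Perm (P.idx j)) :
    ∃ f : P.Hom P, perm f j = σ := by
  obtain ⟨f, hf⟩ := perm_surjective P (Function.update (fun j' => Equiv.refl (P.idx j')) j σ)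
  refine ⟨f, ?_⟩
  have h := congrFun hf j
  simp only [Function.update_self] at h
  exact h

end ProcessionAut

/-! ## 2. The index skeleton of `Prc(^{n,∘}D⊢_T)` and (Ind1) -/

namespace ThetaIndex

variable (T : ThetaIndex)

/-- The INDEX SKELETON of the `l^±`-procession `Prc(^{n,∘}D⊢_T)` ([IUTchI] Prop. 6.9 (i)/(ii), p. 169: "the
`l^±`-procession of `D`-prime-strips … determined by considering the ["sub"]capsules of the capsule `†D_{|T|}`
… corresponding to the subsets `S^±_1 ⊆ … ⊆ S^±_t := {0, 1, 2, …, t−1} ⊆ … ⊆ S^±_{l^±} = |F_l|`"; (ii) its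
mono-analyticisation), as an L5 `Procession` ([IUTchI] Def. 4.10) of length `l^± = l⋇ + 1`: the capsule at
label `j ∈ |F_l| = {0,…,l⋇}` has index set `S^±_{j+1} = T.Caps j = Fin (j+1)`; the constituents `D j i` (the
`D⊢`-prime-strips) are a parameter. TODO-merge: abc-iut-L5-t4/L5-t5 ([IUTchI] Prop. 6.9).
[claim: Mochizuki2012, status: disputed] -/
def prc {C : Type u} (D : ∀ j : T.Label, T.Caps j → C) : Procession C (T.lstar + 1) where
  idx j := T.Caps j
  card_idx j := by simp [Nat.card_eq_fintype_card]
  obj := D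

/-- The capsule index sets of `Prc(^{n,∘}D⊢_T)` are the `S^±_{j+1}` of A — definitionally. [folklore] -/
theorem prc_idx {C : Type u} (D : ∀ j : T.Label, T.Caps j → C) (j : T.Label) : (T.prc D).idx j = T.Caps j :=
  rfl

end ThetaIndex

namespace LogShells

variable {T : ThetaIndex} (L : LogShells T)

/-- The (Ind1)-families at label `j` with a GIVEN permutation `σ` of `S^±_{j+1}`: "permute the `j+1` tensor
factors by `σ` (the same `σ` at every `v_ℚ`), then act on the summand `v` of the factor `i` by an induced
strip-automorphism `h i v ∈ stripAut v`, independently for every `(i, v)`" — the slice of A's `Ind1 j` at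
`σ`. [claim: Mochizuki2012, status: disputed] -/
def ind1Of (j : T.Label) (σ : Equiv.Perm (T.Caps j)) : Set (∀ vQ : T.VQ, L.Packet j vQ ≃ₗ[ℚ] L.Packet j vQ) :=
  {Φ | ∃ h : T.Caps j → ∀ v : T.V, L.carrier v ≃ₗ[ℚ] L.carrier v,
      (∀ i v, h i v ∈ L.stripAut v) ∧
      ∀ vQ, Φ vQ = (L.permute j vQ σ).trans (L.factorwise j vQ fun i => L.summandwise vQ fun v => h i v.1)}

/-- A's (Ind1) at label `j` is the union of its slices over ALL permutations of `S^±_{j+1}` — definitionally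
(A quantifies `∃ σ : Equiv.Perm (T.Caps j)`). [folklore] -/
theorem Ind1_eq_iUnion_perm (j : T.Label) : L.Ind1 j = ⋃ σ : Equiv.Perm (T.Caps j), L.ind1Of j σ := by
  ext Φ
  simp only [Ind1, ind1Of, Set.mem_setOf_eq, Set.mem_iUnion]

/-- **(Ind1) against L5's processions**: A's (Ind1) at label `j` is EXACTLY the union, over the automorphisms
`f` of the procession `Prc(^{n,∘}D⊢_T)` in the sense of [IUTchI] Def. 4.10 as typed by L5
(`Procession.Hom`), of the slices at the permutation `f` induces on the capsule index set `S^±_{j+1}` — for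
any constituent strips `D`. No more: automorphisms preserve labels (`ProcessionAut.ι_apply_self`); no less:
every permutation is induced (`ProcessionAut.perm_surjective`). [claim: Mochizuki2012, status: disputed] -/
theorem Ind1_eq_iUnion_aut {C : Type u} (D : ∀ j : T.Label, T.Caps j → C) (j : T.Label) :
    L.Ind1 j = ⋃ f : (T.prc D).Hom (T.prc D), L.ind1Of j (ProcessionAut.perm f j) := by
  rw [Ind1_eq_iUnion_perm]
  ext Φ
  simp only [Set.mem_iUnion]
  constructor
  · rintro ⟨σ, hΦ⟩
    refine ⟨ProcessionAut.ofPerms (T.prc D) fun j' => if h : j' = j then h ▸ σ else Equiv.refl _, ?_⟩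
    rw [ProcessionAut.perm_ofPerms]
    simpa using hΦ
  · rintro ⟨f, hΦ⟩
    exact ⟨ProcessionAut.perm f j, hΦ⟩

/-- B's label-indexed (Ind1)-FAMILIES (`Ind1Family`: at each label an element of `Ind1 j`) are EXACTLY the
families obtained from the automorphisms of `Prc(^{n,∘}D⊢_T)`: ONE automorphism `f` supplies the permutations
`perm f j` at ALL labels `j ∈ |F_l|` simultaneously, with no cross-label constraint (Def. 4.10).
[claim: Mochizuki2012, status: disputed] -/
theorem Ind1Family_eq_iUnion_aut {C : Type u} (D : ∀ j : T.Label, T.Caps j → C) :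
    L.Ind1Family = ⋃ f : (T.prc D).Hom (T.prc D),
      {Φ | ∀ j, (fun vQ => Φ j vQ) ∈ L.ind1Of j (ProcessionAut.perm f j)} := by
  ext Φ
  simp only [Ind1Family, Set.mem_setOf_eq, Set.mem_iUnion]
  constructor
  · intro hΦ
    have hσ : ∀ j, ∃ σ : Equiv.Perm (T.Caps j), (fun vQ => Φ j vQ) ∈ L.ind1Of j σ := fun j => by
      have := hΦ j
      rw [Ind1_eq_iUnion_perm, Set.mem_iUnion] at this
      exact this
    choose σ hσ using hσ
    refine ⟨ProcessionAut.ofPerms (T.prc D) σ, fun j => ?_⟩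
    rw [ProcessionAut.perm_ofPerms]
    exact hσ j
  · rintro ⟨f, hΦ⟩ j
    rw [Ind1_eq_iUnion_perm, Set.mem_iUnion]
    exact ⟨_, hΦ j⟩

/-- In particular the (Ind1)-permutations act TRANSITIVELY on the capsule index set: for every index `i` of
the `(j+1)`-capsule there is an automorphism of `Prc(^{n,∘}D⊢_T)` whose induced permutation of `S^±_{j+1}` moves
`i` to the distinguished index `j ∈ S^±_{j+1}` (A's `selfIndex j`, the "`α = j`" of the sub-packets of
[IUTchIII] Prop. 3.1 (ii)/3.2) — the transposition `(i j)`. This is the combinatorial fact behind reading the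
union of (Ind1)-images slot by slot (HOME/plan/c312/STEPV-IND1-NOTE.md); recorded, no side taken.
[claim: Mochizuki2012, status: disputed] -/
theorem exists_aut_perm_apply_eq_selfIndex {C : Type u} (D : ∀ j : T.Label, T.Caps j → C) (j : T.Label)
    (i : T.Caps j) :
    ∃ f : (T.prc D).Hom (T.prc D), ProcessionAut.perm f j i = T.selfIndex j := by
  obtain ⟨f, hf⟩ :=
    ProcessionAut.exists_perm_eq (T.prc D) j (Equiv.swap i (T.selfIndex j) : Equiv.Perm (T.Caps j))
  exact ⟨f, by rw [hf]; exact Equiv.swap_apply_left i (T.selfIndex j)⟩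

/-- The number of (Ind1)-permutations at label `j` is `|Perm(S^±_{j+1})| = (j+1)!` (so `2` at `j = 1` and
`(l⋇+1)!` at the top label `j = l⋇`); under this group every index of the `(j+1)`-capsule can occupy each of
the `j+1` positions — cf. [IUTchI] Prop. 6.9 (i) (p. 169): "for each `n ∈ {1, …, l^±}`, there are precisely `n`
possibilities for the element `∈ |F_l|` to which a given index of the index set of the `n`-capsule …
corresponds" (L5 `prod_procession_possibilities`: `∏ n = l^±!` in total). [claim: Mochizuki2012, status: disputed] -/
theorem card_perm_caps (j : T.Label) : Fintype.card (Equiv.Perm (T.Caps j)) = ((j : ℕ) + 1).factorial := by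
  rw [Fintype.card_perm, Fintype.card_fin]

end LogShells

end Thm311

end IUTFork

end Summit.ABC

end
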